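import Summits.QuantumFields.YangMills.Theorems.UnitScaleTiltProp7OneFormRemainderFloorOfLift
import Summits.QuantumFields.YangMills.Theorems.UnitScaleTiltProp7QkOntoOfRegPr
import HarnessLib

/-!
# Route `UnitScaleTilt`, crux K1 «MinimiserStabilityRegPr» (stmt-QuantumFields-19200), EX one-form storey, (P-1FA) FILE A2i —
# **THE KERNEL ROW OF `G₀ = Δ_a(U₀)⁻¹` UNDER `Lift` WITH THE COUPLING-FREE (C_V): the `_abs` edition of (K2-DISCHARGE) D1 ✓`Prop7OneFormGreenKernelRowOfLift.kernelRow_GT_DeltaEtaSlot_of_lift`**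
# (px16 g13 09:45:22Z «YES PLEASE type A2i = the D1-abs edition … in YOUR file — I consume it by name in D2»)

Cell `ym3-torus` (HUMAN RULING D-0037; rung R3 = SU(2) YM₃ on T³ — NOT d = 4, NOT infinite volume, NOT a mass gap, NOT Clay).  Width seat `ym3-torus-px21` g14 (A2 series).  THEOREMS ONLY
(0 `def`, 0 `sorry`, default heartbeats); def-free, `--supports stmt-QuantumFields-19200 --as helper`, count-neutral.

WHY.  D1 ✓`kernelRow_GT_DeltaEtaSlot_of_lift` (p768082) feeds the RATE edition ✓`Prop7OneFormPointwiseDecayRate.kernelRow_GT_DeltaEtaSlot_rate` with every analytic letter but (γ) `hco` and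
`hk_D` discharged BY NAME under `RegPr` + `Lift`; its (C_V) letter `hVlow` is D1's own `hVlow_of_lift`, whose complementary-projector constant `C_P = (m_B(c₁′, a)²·a)⁻¹` uses the COUPLING `a`
of `Δ_a` as the massive weight of the Gram bound and therefore GROWS linearly in `a` — so the displayed window `0 < Θ_r = (1−ε)γ − ε·C_V − 3r²e^{2r}(1+1∕ε) − θ_V` forces `ε, r → 0` along
the (γ) door's coupling floor `a ≥ a₀(c₀∕cB)ℓ³`, `ℓ = L^{K−n}` (px16's flags (F1)∕(F2)).  A2h ✓`Prop7OneFormRemainderFloorOfLift.hVlow_abs_of_lift` decouples the auxiliary weight from the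
coupling and gives (C_V) with the ABSOLUTE constant `C_V = 32√2·ε₀·(d·6^d) + (33∕8)²·600·(27∕4)⁶`.  THIS FILE is D1's theorem VERBATIM with that one `have` swapped: same conclusion
(`ROW(G₀; √2·A₁, min r ¼ ∕ 2)` in O4e's `hk` currency), same displayed letters ((γ) `hco`, `hk_D` at rate `μ′ > r`, `Lift`, `RegPr` + windows, the numeric conditions on `(r, ε)`), but the
`C_V` inside `hΘ` and inside the constant `A₁` is now coupling-free, the coarse-weight binder `c₁′` is gone, and the coupling needs only `0 ≤ a`.  For D2 (the Idx ∃-package): `(ε, r)` can be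
chosen from `γco L` and the `hk_D` constant alone ⟹ the rate `min r ¼ ∕ 2` is K-UNIFORM.

WHAT IS PROVED (ns `Summit.QuantumFields.YangMills.Theorems.Prop7OneFormGreenKernelRowOfLiftAbs`; member `F`, `n < K`).
* ★★★ `kernelRow_GT_DeltaEtaSlot_of_lift_abs` — as described; proof = D1's: `PosOnto` from (γ) + ✓`surjective_Qk_of_regPr`; `hQ` ⟸ ✓`norm_Qk_le_of_regPr`; `hVconj` ⟸ A2g
  ✓`hVconj_phaseClass_of_letters`; `hVlow` ⟸ A2h ✓`hVlow_abs_of_lift`; `hkQ` ⟸ ✓`hkQ_of_regPr`; then ✓`kernelRow_GT_DeltaEtaSlot_rate`.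
HONEST SCOPE.  A re-knit of landed theorems; CONDITIONAL on (γ) `hco`, `hk_D`, `Lift` and the displayed numeric conditions; nothing of the ten EX rows, `hT`, (3.42)∕(3.46) for print's
`G`∕`H`, EX or the crux is proved here; no summit is proved by a helper.  Credit: the statement and proof architecture are px16 g13's D1; this file changes one supplier.

References: T. Bałaban, CMP **99** (1985) 389–434 [Balaban1985BackgroundPropagators] (Thm 3.1 (3.42) p.397, (3.21)–(3.27) pp.394–395, (3.46) p.398, (3.49) p.399, Thm 3.11 p.416,
Thm 3.12 p.422); CMP **102** (1985) 277–309 [Balaban1985Variational] ((134)–(136) p.298).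
-/

set_option autoImplicit false

noncomputable section

open scoped Matrix.Norms.L2Operator BigOperators InnerProductSpace ComplexConjugate

namespace Summit.QuantumFields.YangMills.Theorems.Prop7OneFormGreenKernelRowOfLiftAbs

open Literature.MathematicalPhysics.QuantumFieldTheory.Balaban1983to89
open Literature.MathematicalPhysics.QuantumFieldTheory.Balaban1983to89.T3ContinuumYM3Torus
open Literature.MathematicalPhysics.QuantumFieldTheory.Balaban1983to89.T3PrintedRegularMinimiser (RegPr)
open T4Continuum BlockAveraging
open BlockAveraging (Idx)
open B7Prop1Explicit (disp)
open B10Eq27TorusAxialLog (holT transl)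
open B7TransferAnalyticMean (meanCLM)
open B15DeterminingSets (embIter)
open T3SectALandauChart (formComp bgUnits eta eta_pos)
open B4Sect5Torus (TSite)
open B9SectCLatticeCarrier (Bond)
open B9Eq311L2Pairing (WL2)
open B11Eq103H1Complex (SiteL2K BondL2K projR)
open B5Eq118OneStroke (iterBlockOf)
open Summit.QuantumFields.YangMills.Theorems.Prop8Chart (emlIterU)
open Summit.QuantumFields.YangMills.Theorems.Prop7SectET3Transport (periodsT3 siteEquiv bondEquiv)
open Summit.QuantumFields.YangMills.Theorems.Prop7SectET3HilbertLetters (W₂ frobEquiv toL2 toL2S DL2 DstarL2 covLapSite)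
open Summit.QuantumFields.YangMills.Theorems.Prop7SectET3WilsonHessian (DeltaEta DeltaEtaSlot)
open Summit.QuantumFields.YangMills.Theorems.Prop7SectET3GaugeProjector (NS RS)
open Summit.QuantumFields.YangMills.Theorems.Prop7SectET3CurvedPropagators (laplaceA Qk GT PosOnto)
open Summit.QuantumFields.YangMills.Theorems.Prop7OneFormAgmonPhaseClass (hVconj_phaseClass_of_letters)
open Summit.QuantumFields.YangMills.Theorems.Prop7QkPenaltyKernelRowOfRegPr (hkQ_of_regPr)
open Summit.QuantumFields.YangMills.Theorems.Prop7QkAdjointSupRowOfRegPr (norm_Qk_le_of_regPr)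
open Summit.QuantumFields.YangMills.Theorems.Prop7QkOntoOfRegPr (surjective_Qk_of_regPr)
open Summit.QuantumFields.YangMills.Theorems.Prop7OneFormPointwiseDecayRate (kernelRow_GT_DeltaEtaSlot_rate)
open Summit.QuantumFields.YangMills.Theorems.Prop7OneFormRemainderFloorOfLift (hVlow_abs_of_lift)

variable (F : T3Family) {n K : ℕ} (h : n ≤ K) (c₀ cB : ℝ) [Fact (0 < c₀)] [Fact (0 < cB)]

/-- ★★★ **THE KERNEL ROW OF `G₀ = Δ_a(U₀)⁻¹` AT `DeltaEtaSlot` UNDER `Lift` AT `RegPr`, COUPLING-FREE (C_V)** — D1 ✓`kernelRow_GT_DeltaEtaSlot_of_lift` with `hVlow` ⟸ A2h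
✓`hVlow_abs_of_lift`.  Displayed: `n < K`; `RegPr F n K ε₀ U₀` with `0 < ε₀`, `10¹²L³ε₀ ≤ 1`, `10¹⁰L⁶ε₀ ≤ 1`, `13·10¹⁴L³ε₀ ≤ 1`; `Lift`; the coupling `a ≥ 0`; (γ) `hco` (`0 < γ`); `hk_D`
(E2E's text) at a rate `μ′ > r > 0`; and the two NUMERIC conditions on `(r, ε)`: `0 < Θ_r` with the ABSOLUTE `C_V := 32√2·ε₀·(d·6^d) + (33∕8)²·600·(27∕4)⁶` (and `θ_V` := A2g's phase-class
constant at `Ck := CkD`, `C_Q := 6√(cB∕c₀)√ℓ⁻³`) and `(32√2ε₀e^{5r})(8e^{3r})·14 < 1`.  THEN `∀ b Z bd, ‖toL2⁻¹(G₀(toL2 δ_bZ)) bd‖ ≤ √2·A₁·e^{−(min r ¼ ∕ 2)·tdist(B b₋, B bd₋)}·‖Z‖`.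
[cite: Balaban1985BackgroundPropagators, Thm 3.1 (3.42) p.397, (3.21)–(3.27) pp.394–395, (3.46) p.398, (3.49) p.399, Thm 3.11 p.416, Thm 3.12 p.422] -/
theorem kernelRow_GT_DeltaEtaSlot_of_lift_abs (hnK : n < K) {ε₀ : ℝ} (hε₀ : 0 < ε₀) (hWε : 10 ^ 12 * (F.L : ℝ) ^ 3 * ε₀ ≤ 1)
    (hε10 : 10 ^ 10 * (F.L : ℝ) ^ 6 * ε₀ ≤ 1) (hwin : 13 * 10 ^ 14 * (F.L : ℝ) ^ 3 * ε₀ ≤ 1)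
    (U₀ : GaugeField (F.P K) 0 (Matrix.specialUnitaryGroup (Fin 2) ℂ)) (hreg : RegPr F n K ε₀ U₀)
    (hlift : ∀ cf : Site (F.P K) (K - n) → Matrix (Fin 2) (Fin 2) ℂ,
        (∀ e : PBond (F.P K) (K - n), cf e.src = ((emlIterU (K - n) (bgUnits F K U₀) e : (Matrix (Fin 2) (Fin 2) ℂ)ˣ) : Matrix (Fin 2) (Fin 2) ℂ) * cf e.tgt *
          (((emlIterU (K - n) (bgUnits F K U₀) e)⁻¹ : (Matrix (Fin 2) (Fin 2) ℂ)ˣ) : Matrix (Fin 2) (Fin 2) ℂ)) →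
        ∃ l₀ : Site (F.P K) 0 → Matrix (Fin 2) (Fin 2) ℂ,
          (∀ b : PBond (F.P K) 0, l₀ b.src = ((bgUnits F K U₀ b : (Matrix (Fin 2) (Fin 2) ℂ)ˣ) : Matrix (Fin 2) (Fin 2) ℂ) * l₀ b.tgt * (((bgUnits F K U₀ b)⁻¹ : (Matrix (Fin 2) (Fin 2) ℂ)ˣ) : Matrix (Fin 2) (Fin 2) ℂ)) ∧
          ∀ y : Site (F.P K) (K - n), l₀ (embIter (K - n) y) = cf y)
    {a : ℝ} (ha : 0 ≤ a)
    {γ : ℝ} (hγ : 0 < γ) (hco : ∀ v : BondL2K ℂ 3 (periodsT3 F K) c₀ W₂, γ * ‖v‖ ^ 2 ≤ RCLike.re ⟪v, laplaceA F n K h c₀ cB a (DeltaEtaSlot F n K c₀) U₀ v⟫_ℂ)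
    {r μ' CkD : ℝ} (hr : 0 < r) (hrμ : r < μ') (hCkD : 0 ≤ CkD)
    (hkD : ∀ (b : PBond (F.P K) 0) (Z : Matrix (Fin 2) (Fin 2) ℂ) (bd : PBond (F.P K) 0),
      ‖(toL2 F K c₀).symm (DL2 F n K c₀ U₀ (DstarL2 F n K c₀ U₀ (toL2 F K c₀ (Pi.single b Z))
          - RS F n K h c₀ cB U₀ (DstarL2 F n K c₀ U₀ (toL2 F K c₀ (Pi.single b Z))))) bd‖
        ≤ CkD * Real.exp (-(μ' * (Site.tdist (P := F.P K) (iterBlockOf (K - n) b.src) (iterBlockOf (K - n) bd.src) : ℝ))) * ‖Z‖)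
    {ε : ℝ} (hε : 0 < ε) (hε1 : ε ≤ 1)
    (hΘ : 0 < ((1 - ε) * γ - ε * ((32 * Real.sqrt 2 * ε₀ * (((F.P K).d : ℝ) * (2 * 3) ^ (F.P K).d)) + (33 / 8 : ℝ) ^ 2 * (600 * (27 / 4 : ℝ) ^ 6)) - 3 * (r ^ 2 * Real.exp (2 * r)) * (1 + 1 / ε)
            - (a * (2 * Real.sqrt (216 * (Real.exp (r * (((F.P K).d : ℝ) + 1)) - 1) ^ 2 * (cB / (c₀ * ((F.L : ℝ) ^ (K - n)) ^ 3))) * (6 * Real.sqrt (cB / c₀) * Real.sqrt (((F.L : ℝ) ^ (K - n))⁻¹ ^ 3))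
                  + 216 * (Real.exp (r * (((F.P K).d : ℝ) + 1)) - 1) ^ 2 * (cB / (c₀ * ((F.L : ℝ) ^ (K - n)) ^ 3)))
              + Real.sqrt 2 * CkD * (r * (F.P K).d * Real.exp (r * (F.P K).d) / min 1 ((μ' - r) / 2))
                  * (((F.P K).d : ℝ) * ((((F.P K).L : ℝ) ^ (F.P K).d) ^ (K - n)) * (2 * (1 + 1 / (μ' - (r + min 1 ((μ' - r) / 2))))) ^ 3)
              + 32 * Real.sqrt 2 * ε₀ * (((F.P K).d : ℝ) * (2 * 3) ^ (F.P K).d) * (1 + Real.exp (2 * r)))))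
    (hsmall : (32 * Real.sqrt 2 * ε₀ * Real.exp (5 * r)) * (8 * Real.exp (3 * r)) * 14 < 1)
    (b : PBond (F.P K) 0) (Z : Matrix (Fin 2) (Fin 2) ℂ) (bd : PBond (F.P K) 0) :
    ‖(toL2 F K c₀).symm (GT F n K h c₀ cB a (DeltaEtaSlot F n K c₀) U₀ (toL2 F K c₀ (Pi.single b Z))) bd‖
      ≤ Real.sqrt 2 *
          (((1 + Real.sqrt 2 * (((2 * a * 5 ^ 2 * (cB / c₀) * ((F.L : ℝ) ^ (K - n))⁻¹ ^ 6 * Real.exp μ') + CkD) * Real.sqrt (((F.P K).d : ℝ) * ((((F.P K).L : ℝ) ^ (F.P K).d) ^ (K - n)) / c₀) * (Real.exp (6 * r) * Real.sqrt c₀ / ((1 - ε) * γ - ε * ((32 * Real.sqrt 2 * ε₀ * (((F.P K).d : ℝ) * (2 * 3) ^ (F.P K).d)) + (33 / 8 : ℝ) ^ 2 * (600 * (27 / 4 : ℝ) ^ 6)) - 3 * (r ^ 2 * Real.exp (2 * r)) * (1 + 1 / ε)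
            - (a * (2 * Real.sqrt (216 * (Real.exp (r * (((F.P K).d : ℝ) + 1)) - 1) ^ 2 * (cB / (c₀ * ((F.L : ℝ) ^ (K - n)) ^ 3))) * (6 * Real.sqrt (cB / c₀) * Real.sqrt (((F.L : ℝ) ^ (K - n))⁻¹ ^ 3))
                  + 216 * (Real.exp (r * (((F.P K).d : ℝ) + 1)) - 1) ^ 2 * (cB / (c₀ * ((F.L : ℝ) ^ (K - n)) ^ 3)))
              + Real.sqrt 2 * CkD * (r * (F.P K).d * Real.exp (r * (F.P K).d) / min 1 ((μ' - r) / 2))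
                  * (((F.P K).d : ℝ) * ((((F.P K).L : ℝ) ^ (F.P K).d) ^ (K - n)) * (2 * (1 + 1 / (μ' - (r + min 1 ((μ' - r) / 2))))) ^ 3)
              + 32 * Real.sqrt 2 * ε₀ * (((F.P K).d : ℝ) * (2 * 3) ^ (F.P K).d) * (1 + Real.exp (2 * r))))) * (2 * (1 + 1 / (μ' - r))) ^ 3)) * (8 * Real.exp (3 * r)) * 14
              + Real.sqrt (3 ^ 3 * 8 / (c₀ * ((F.L : ℝ) ^ (K - n)) ^ 3)) * (Real.sqrt (8 * Real.exp (3 * r) * (2 * (1 + 1 / r)) ^ 3) * (Real.exp (6 * r) * Real.sqrt c₀ / ((1 - ε) * γ - ε * ((32 * Real.sqrt 2 * ε₀ * (((F.P K).d : ℝ) * (2 * 3) ^ (F.P K).d)) + (33 / 8 : ℝ) ^ 2 * (600 * (27 / 4 : ℝ) ^ 6)) - 3 * (r ^ 2 * Real.exp (2 * r)) * (1 + 1 / ε)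
            - (a * (2 * Real.sqrt (216 * (Real.exp (r * (((F.P K).d : ℝ) + 1)) - 1) ^ 2 * (cB / (c₀ * ((F.L : ℝ) ^ (K - n)) ^ 3))) * (6 * Real.sqrt (cB / c₀) * Real.sqrt (((F.L : ℝ) ^ (K - n))⁻¹ ^ 3))
                  + 216 * (Real.exp (r * (((F.P K).d : ℝ) + 1)) - 1) ^ 2 * (cB / (c₀ * ((F.L : ℝ) ^ (K - n)) ^ 3)))
              + Real.sqrt 2 * CkD * (r * (F.P K).d * Real.exp (r * (F.P K).d) / min 1 ((μ' - r) / 2))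
                  * (((F.P K).d : ℝ) * ((((F.P K).L : ℝ) ^ (F.P K).d) ^ (K - n)) * (2 * (1 + 1 / (μ' - (r + min 1 ((μ' - r) / 2))))) ^ 3)
              + 32 * Real.sqrt 2 * ε₀ * (((F.P K).d : ℝ) * (2 * 3) ^ (F.P K).d) * (1 + Real.exp (2 * r)))))))
            / (1 - (32 * Real.sqrt 2 * ε₀ * Real.exp (5 * r)) * (8 * Real.exp (3 * r)) * 14))
        * Real.exp (-((min r (1 / 4) / 2) * (Site.tdist (P := F.P K) (iterBlockOf (K - n) b.src) (iterBlockOf (K - n) bd.src) : ℝ))) * ‖Z‖ := by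
  have hc₀ : 0 < c₀ := Fact.out
  have hcB : 0 < cB := Fact.out
  -- `PosOnto` from (γ) and «Q onto»
  have hp : PosOnto F n K h c₀ cB a (DeltaEtaSlot F n K c₀) U₀ :=
    ⟨fun x hx => lt_of_lt_of_le (mul_pos hγ (pow_pos (norm_pos_iff.mpr hx) 2)) (hco x), surjective_Qk_of_regPr F h hnK c₀ cB hreg hwin⟩
  -- the letters fed by name
  have hQ : ∀ v : BondL2K ℂ 3 (periodsT3 F K) c₀ W₂, ‖Qk F n K h c₀ cB U₀ v‖ ≤ (6 * Real.sqrt (cB / c₀) * Real.sqrt (((F.L : ℝ) ^ (K - n))⁻¹ ^ 3)) * ‖v‖ :=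
    fun v => norm_Qk_le_of_regPr F h c₀ cB hε₀ hε10 hWε U₀ hreg v
  have hVconj := hVconj_phaseClass_of_letters F h c₀ cB (a := a) hε₀ hε10 hWε U₀ hreg ha hr.le hrμ hCkD hkD hQ
  have hVlow := hVlow_abs_of_lift F h c₀ cB (a := a) hnK hε₀ hWε U₀ hreg ha hlift
  have hkQ := hkQ_of_regPr F h c₀ cB hε₀ hε10 hWε U₀ hreg ha (le_of_lt (hr.trans hrμ))
  exact kernelRow_GT_DeltaEtaSlot_rate (h := h) (cB := cB) (a := a) hnK.le hε₀.le U₀ hreg hp hr hε hε1 hco hVlow hVconj hΘ hCkD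
    (by positivity) hrμ hkD hkQ hsmall b Z bd

end Summit.QuantumFields.YangMills.Theorems.Prop7OneFormGreenKernelRowOfLiftAbs

end
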